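import Mathlib.Algebra.Homology.DerivedCategory.ShortExact
import Mathlib.CategoryTheory.Abelian.Refinements
import Mathlib.CategoryTheory.Shift.ShiftedHom
import HarnessLib

/-!
# The connecting morphisms of a `3 × 3` diagram ANTICOMMUTE in the derived category
# (gs-g4 gen 22, brick C6a of `general-structure/COMPLEX-LEIBNIZ-PLAN-gs-g4.md`: the engine of "centrality")

HONEST FRAMING. Generic homological algebra (Mathlib level): abelian categories, Mathlib's
`DerivedCategory.triangleOfSESδ`, diagram chasing "up to refinements". Nothing about any variety; nothing here says
HC, HC_CM or HC_AV is proved.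

SETTING. A `3 × 3` diagram in an abelian category `A` is packaged as a short complex of short complexes
`D : ShortComplex (ShortComplex A)`: the COLUMNS are `D.X₁, D.X₂, D.X₃` (each `0 → A_{1k} → A_{2k} → A_{3k} → 0`),
the ROWS are the componentwise sequences `row₁ D = (D.f.τ₁, D.g.τ₁)`, `row₃ D = (D.f.τ₃, D.g.τ₃)` (the middle
row need only be a complex, which `D.zero` provides). HYPOTHESES: rows `1, 3` and columns `1, 2, 3` short exact.

WHAT IS PROVED (`namespace Summit.Ventures.HSemireg.NineDiagram`).
* The CORNER object `K D = ker(A₂₂ → A₃₃)` with its two short exact sequences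
  `Σ : 0 → K → A₂₂ → A₃₃ → 0` (`sigma_shortExact`) and `Θ : 0 → A₁₁ → A₂₁ ⊞ A₁₂ → K → 0`
  (`theta_shortExact`, first map `(u₁, -i₁)`, second map "sum"; exactness by diagram chasing up to refinements, using
  only columns `1, 2` exact and row `3` exact), and the four comparison morphisms of short complexes
  `Σ → row₃`, `Σ → col₃`, `Θ → col₁` (first component `𝟙`), `Θ → row₁` (first component `-𝟙`).
* **`triangleOfSESδ_row₃_col₁_eq_neg`** — in `A = CochainComplex C ℤ`:
  `δ(row₃) ≫ δ(col₁)⟦1⟧' = -(δ(col₃) ≫ δ(row₁)⟦1⟧')` as morphisms `Q A₃₃ ⟶ (Q A₁₁)⟦1⟧⟦1⟧`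
  (both composites factor through `δ_Σ`, and `Q(l₃₁) ≫ δ(col₁) = δ_Θ = -(Q(l₁₃) ≫ δ(row₁))` by naturality of
  `triangleOfSESδ` along the four comparison morphisms); **`comp_triangleOfSESδ_anticomm`** — the same in
  Mathlib's `ShiftedHom.comp` form (degree `1 + 1 = 2`).
USE (sequel `AtiyahNuCommute`): rows = the `Ωʲ⁺¹`- and `Ωʲ`-twisted Atiyah sequences of a complex, columns = the
`dlog`-wedge cocycle extensions; conclusion = the Atiyah steps commute with the classes `ν_j = 1 ⊗ [dlog c]`.

## References

* H. Cartan, S. Eilenberg, *Homological Algebra* (1956), Prop. III.4.1 / IV.2.1 (anticommutativity of the two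
  connecting homomorphisms of a `3 × 3` diagram). [folklore]
* G. Bergman, *A note on abelian categories — translating element-chasing proofs* (1974) (refinements; Mathlib
  `CategoryTheory.Abelian.Refinements`).
-/

noncomputable section

open CategoryTheory CategoryTheory.Limits CategoryTheory.Category

namespace Summit.Ventures.HSemireg

namespace NineDiagram

universe w v u

section Abelian

variable {A : Type u} [Category.{v} A] [Abelian A] (D : ShortComplex (ShortComplex A))

/-! ### Rows, the corner object and the two auxiliary short exact sequences -/

/-- The middle row of the `3 × 3` diagram is a complex: `i₂ ≫ p₂ = 0`. [folklore] -/
theorem τ₂_comp_τ₂ : D.f.τ₂ ≫ D.g.τ₂ = 0 := by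
  rw [← ShortComplex.comp_τ₂, D.zero, ShortComplex.zero_τ₂]

/-- **Row 1** `0 → A₁₁ → A₁₂ → A₁₃ → 0` (first components). [folklore] -/
abbrev row₁ : ShortComplex A :=
  ShortComplex.mk D.f.τ₁ D.g.τ₁ (by rw [← ShortComplex.comp_τ₁, D.zero, ShortComplex.zero_τ₁])

/-- **Row 3** `0 → A₃₁ → A₃₂ → A₃₃ → 0` (third components). [folklore] -/
abbrev row₃ : ShortComplex A :=
  ShortComplex.mk D.f.τ₃ D.g.τ₃ (by rw [← ShortComplex.comp_τ₃, D.zero, ShortComplex.zero_τ₃])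

/-- `row₁` unfolded. [folklore] -/
@[simp] theorem row₁_f : (row₁ D).f = D.f.τ₁ := rfl
/-- `row₁` unfolded. [folklore] -/
@[simp] theorem row₁_g : (row₁ D).g = D.g.τ₁ := rfl
/-- `row₃` unfolded. [folklore] -/
@[simp] theorem row₃_f : (row₃ D).f = D.f.τ₃ := rfl
/-- `row₃` unfolded. [folklore] -/
@[simp] theorem row₃_g : (row₃ D).g = D.g.τ₃ := rfl

/-- The diagonal epimorphism `f₀ = v₂ ≫ p₃ : A₂₂ ⟶ A₃₃`. [folklore] -/
abbrev f₀ : D.X₂.X₂ ⟶ D.X₃.X₃ := D.X₂.g ≫ D.g.τ₃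

/-- `f₀ = p₂ ≫ v₃` as well. [folklore] -/
theorem f₀_eq : f₀ D = D.g.τ₂ ≫ D.X₃.g := (D.g.comm₂₃).symm

/-- **The corner object** `K = ker(A₂₂ → A₃₃)` ("`A₂₁ + A₁₂` inside `A₂₂`"). [folklore] -/
abbrev K : A := kernel (f₀ D)

/-- **`Σ : 0 → K → A₂₂ → A₃₃ → 0`.** [folklore] -/
abbrev sigma : ShortComplex A := ShortComplex.mk (kernel.ι (f₀ D)) (f₀ D) (kernel.condition _)

/-- `Σ` is short exact as soon as `v₂` and `p₃` are epimorphisms. [folklore] -/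
theorem sigma_shortExact [Epi D.X₂.g] [Epi D.g.τ₃] : (sigma D).ShortExact where
  exact := ShortComplex.exact_of_f_is_kernel _ (kernelIsKernel (f₀ D))
  mono_f := by dsimp [sigma]; infer_instance
  epi_g := by dsimp [sigma, f₀]; exact epi_comp _ _

/-- `a : A₂₁ ⟶ K` (the row map `i₂` lands in the corner). [folklore] -/
def a : D.X₁.X₂ ⟶ K D :=
  kernel.lift (f₀ D) D.f.τ₂ (by
    rw [f₀, ← assoc, D.f.comm₂₃, assoc, ← ShortComplex.comp_τ₃, D.zero, ShortComplex.zero_τ₃, comp_zero])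

/-- `b : A₁₂ ⟶ K` (the column map `u₂` lands in the corner). [folklore] -/
def b : D.X₂.X₁ ⟶ K D :=
  kernel.lift (f₀ D) D.X₂.f (by rw [f₀, D.X₂.zero_assoc, zero_comp])

/-- `a ≫ ι_K = i₂`. [folklore] -/
@[simp] theorem a_ι : a D ≫ kernel.ι (f₀ D) = D.f.τ₂ := kernel.lift_ι _ _ _

/-- `b ≫ ι_K = u₂`. [folklore] -/
@[simp] theorem b_ι : b D ≫ kernel.ι (f₀ D) = D.X₂.f := kernel.lift_ι _ _ _

variable {D}

/-- `l₃₁ : K ⟶ A₃₁` — the corner maps to `A₃₂` inside `ker p₃ = A₃₁` (row `3` exact). [folklore] -/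
def l₃₁ (hr₃ : (row₃ D).ShortExact) : K D ⟶ D.X₁.X₃ :=
  letI := hr₃.mono_f
  hr₃.exact.lift (kernel.ι (f₀ D) ≫ D.X₂.g) (by rw [assoc]; exact kernel.condition _)

/-- `l₃₁ ≫ i₃ = ι_K ≫ v₂`. [folklore] -/
@[simp] theorem l₃₁_f (hr₃ : (row₃ D).ShortExact) : l₃₁ hr₃ ≫ D.f.τ₃ = kernel.ι (f₀ D) ≫ D.X₂.g := by
  letI := hr₃.mono_f
  exact hr₃.exact.lift_f _ _

/-- `l₁₃ : K ⟶ A₁₃` — the corner maps to `A₂₃` inside `ker v₃ = A₁₃` (column `3` exact). [folklore] -/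
def l₁₃ (hc₃ : D.X₃.ShortExact) : K D ⟶ D.X₃.X₁ :=
  letI := hc₃.mono_f
  hc₃.exact.lift (kernel.ι (f₀ D) ≫ D.g.τ₂) (by rw [assoc, ← f₀_eq]; exact kernel.condition _)

/-- `l₁₃ ≫ u₃ = ι_K ≫ p₂`. [folklore] -/
@[simp] theorem l₁₃_f (hc₃ : D.X₃.ShortExact) : l₁₃ hc₃ ≫ D.X₃.f = kernel.ι (f₀ D) ≫ D.g.τ₂ := by
  letI := hc₃.mono_f
  exact hc₃.exact.lift_f _ _

/-- `a ≫ l₃₁ = v₁`. [folklore] -/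
theorem a_l₃₁ (hr₃ : (row₃ D).ShortExact) : a D ≫ l₃₁ hr₃ = D.X₁.g := by
  haveI := hr₃.mono_f
  rw [← cancel_mono (row₃ D).f, row₃_f, assoc, l₃₁_f, ← assoc, a_ι, D.f.comm₂₃]

/-- `b ≫ l₃₁ = 0`. [folklore] -/
theorem b_l₃₁ (hr₃ : (row₃ D).ShortExact) : b D ≫ l₃₁ hr₃ = 0 := by
  haveI := hr₃.mono_f
  rw [← cancel_mono (row₃ D).f, row₃_f, assoc, l₃₁_f, ← assoc, b_ι, D.X₂.zero, zero_comp]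

/-- `a ≫ l₁₃ = 0`. [folklore] -/
theorem a_l₁₃ (hc₃ : D.X₃.ShortExact) : a D ≫ l₁₃ hc₃ = 0 := by
  haveI := hc₃.mono_f
  rw [← cancel_mono D.X₃.f, assoc, l₁₃_f, ← assoc, a_ι, τ₂_comp_τ₂, zero_comp]

/-- `b ≫ l₁₃ = p₁`. [folklore] -/
theorem b_l₁₃ (hc₃ : D.X₃.ShortExact) : b D ≫ l₁₃ hc₃ = D.g.τ₁ := by
  haveI := hc₃.mono_f
  rw [← cancel_mono D.X₃.f, assoc, l₁₃_f, ← assoc, b_ι, D.g.comm₁₂]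

variable (D)

/-- `(a + b) ≫ ι_K = (i₂, u₂)`. [folklore] -/
theorem desc_ι : biprod.desc (a D) (b D) ≫ kernel.ι (f₀ D) = biprod.desc D.f.τ₂ D.X₂.f := by
  refine biprod.hom_ext' _ _ ?_ ?_
  · rw [biprod.inl_desc_assoc, biprod.inl_desc, a_ι]
  · rw [biprod.inr_desc_assoc, biprod.inr_desc, b_ι]

/-- **`Θ : 0 → A₁₁ → A₂₁ ⊞ A₁₂ → K → 0`**, first map `(u₁, -i₁)`, second map `a + b`. [folklore] -/
abbrev theta : ShortComplex A :=
  ShortComplex.mk (biprod.lift D.X₁.f (-D.f.τ₁)) (biprod.desc (a D) (b D)) (by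
    rw [← cancel_mono (kernel.ι (f₀ D)), zero_comp, assoc, desc_ι, biprod.lift_desc, Preadditive.neg_comp,
      D.f.comm₁₂, add_neg_cancel])

/-- Values of `x ≫ (a + b) ≫ ι_K`. [folklore] -/
theorem comp_desc_ι {T : A} (x : T ⟶ D.X₁.X₂ ⊞ D.X₂.X₁) :
    x ≫ biprod.desc (a D) (b D) ≫ kernel.ι (f₀ D) = (x ≫ biprod.fst) ≫ D.f.τ₂ + (x ≫ biprod.snd) ≫ D.X₂.f := by
  have hx : x = biprod.lift (x ≫ biprod.fst) (x ≫ biprod.snd) := by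
    refine biprod.hom_ext _ _ ?_ ?_ <;> simp
  rw [desc_ι]
  conv_lhs => rw [hx]
  rw [biprod.lift_desc]

/-- **`Θ` is short exact** (diagram chase up to refinements; uses: columns `1`, `2` exact, row `3` exact).
[folklore] -/
theorem theta_shortExact (hc₁ : D.X₁.ShortExact) (hc₂ : D.X₂.ShortExact) (hr₃ : (row₃ D).ShortExact) :
    (theta D).ShortExact := by
  haveI := hc₁.mono_f
  haveI := hc₁.epi_g
  haveI := hc₂.mono_f
  haveI := hr₃.mono_f
  refine ShortComplex.ShortExact.mk' ?_ (mono_of_mono_fac (biprod.lift_fst _ _)) ?_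
  · -- exactness at `A₂₁ ⊞ A₁₂`
    rw [ShortComplex.exact_iff_exact_up_to_refinements]
    intro T x hx
    change x ≫ biprod.desc (a D) (b D) = 0 at hx
    have h0 : (x ≫ biprod.fst) ≫ D.f.τ₂ + (x ≫ biprod.snd) ≫ D.X₂.f = 0 := by
      rw [← comp_desc_ι, reassoc_of% hx, zero_comp]
    -- apply `v₂`: `(x ≫ fst) ≫ v₁ ≫ i₃ = 0`, hence `(x ≫ fst) ≫ v₁ = 0`
    have h1 : (x ≫ biprod.fst) ≫ D.X₁.g = 0 := by
      have h := congrArg (· ≫ D.X₂.g) h0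
      simp only [Preadditive.add_comp, assoc, D.X₂.zero, comp_zero, add_zero, zero_comp] at h
      rw [← cancel_mono D.f.τ₃, zero_comp, assoc, assoc, ← D.f.comm₂₃]
      exact h
    have h2 : x ≫ biprod.snd ≫ D.X₂.f = -(x ≫ biprod.fst ≫ D.f.τ₂) := by
      rw [eq_neg_iff_add_eq_zero, add_comm, ← assoc, ← assoc]; exact h0
    obtain ⟨T', π, hπ, y, hy⟩ := hc₁.exact.exact_up_to_refinements (x ≫ biprod.fst) h1
    refine ⟨T', π, hπ, y, ?_⟩
    change π ≫ x = y ≫ biprod.lift D.X₁.f (-D.f.τ₁)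
    refine biprod.hom_ext _ _ ?_ ?_
    · rw [assoc, hy, assoc, biprod.lift_fst]
    · rw [← cancel_mono D.X₂.f]
      simp only [assoc, biprod.lift_snd]
      rw [Preadditive.neg_comp, Preadditive.comp_neg, D.f.comm₁₂, ← reassoc_of% hy, h2, Preadditive.comp_neg]
  · -- `a + b` is an epimorphism
    change Epi (biprod.desc (a D) (b D))
    rw [epi_iff_surjective_up_to_refinements]
    intro T d
    obtain ⟨T₁, π₁, hπ₁, e', h₁⟩ := hr₃.exact.exact_up_to_refinements (d ≫ kernel.ι (f₀ D) ≫ D.X₂.g) (by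
      change (d ≫ kernel.ι (f₀ D) ≫ D.X₂.g) ≫ D.g.τ₃ = 0
      rw [assoc, assoc]; exact (congrArg (d ≫ ·) (kernel.condition (f₀ D))).trans comp_zero)
    change π₁ ≫ d ≫ kernel.ι (f₀ D) ≫ D.X₂.g = e' ≫ D.f.τ₃ at h₁
    obtain ⟨T₂, π₂, hπ₂, m', h₂⟩ := surjective_up_to_refinements_of_epi D.X₁.g e'
    have h3 : (π₂ ≫ π₁ ≫ d ≫ kernel.ι (f₀ D) - m' ≫ D.f.τ₂) ≫ D.X₂.g = 0 := by
      rw [Preadditive.sub_comp, assoc, assoc, assoc, h₁, ← assoc π₂, h₂, assoc, assoc, ← D.f.comm₂₃, sub_self]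
    obtain ⟨T₃, π₃, hπ₃, m, h₃⟩ := hc₂.exact.exact_up_to_refinements _ h3
    refine ⟨T₃, π₃ ≫ π₂ ≫ π₁, inferInstance, biprod.lift (π₃ ≫ m') m, ?_⟩
    rw [← cancel_mono (kernel.ι (f₀ D))]
    simp only [assoc]
    rw [comp_desc_ι, biprod.lift_fst, biprod.lift_snd, ← h₃, Preadditive.comp_sub, assoc]
    abel

/-! ### The four comparison morphisms -/

variable {D}

/-- `Σ ⟶ row₃`: `(l₃₁, v₂, 𝟙)`. [folklore] -/
def sigmaToRow₃ (hr₃ : (row₃ D).ShortExact) : sigma D ⟶ row₃ D where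
  τ₁ := l₃₁ hr₃
  τ₂ := D.X₂.g
  τ₃ := 𝟙 _
  comm₁₂ := l₃₁_f hr₃
  comm₂₃ := (comp_id _).symm

/-- `Σ ⟶ col₃`: `(l₁₃, p₂, 𝟙)`. [folklore] -/
def sigmaToCol₃ (hc₃ : D.X₃.ShortExact) : sigma D ⟶ D.X₃ where
  τ₁ := l₁₃ hc₃
  τ₂ := D.g.τ₂
  τ₃ := 𝟙 _
  comm₁₂ := l₁₃_f hc₃
  comm₂₃ := by
    change D.g.τ₂ ≫ D.X₃.g = f₀ D ≫ 𝟙 _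
    rw [comp_id]; exact D.g.comm₂₃

/-- `Θ ⟶ col₁`: `(𝟙, pr₁, l₃₁)`. [folklore] -/
def thetaToCol₁ (hr₃ : (row₃ D).ShortExact) : theta D ⟶ D.X₁ where
  τ₁ := 𝟙 _
  τ₂ := biprod.fst
  τ₃ := l₃₁ hr₃
  comm₁₂ := by
    change 𝟙 _ ≫ D.X₁.f = biprod.lift D.X₁.f (-D.f.τ₁) ≫ biprod.fst
    rw [id_comp, biprod.lift_fst]
  comm₂₃ := by
    change biprod.fst ≫ D.X₁.g = biprod.desc (a D) (b D) ≫ l₃₁ hr₃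
    refine biprod.hom_ext' _ _ ?_ ?_
    · rw [biprod.inl_fst_assoc, biprod.inl_desc_assoc, a_l₃₁]
    · rw [biprod.inr_fst_assoc, biprod.inr_desc_assoc, b_l₃₁, zero_comp]

/-- `Θ ⟶ row₁`: `(-𝟙, pr₂, l₁₃)`. [folklore] -/
def thetaToRow₁ (hc₃ : D.X₃.ShortExact) : theta D ⟶ row₁ D where
  τ₁ := -𝟙 _
  τ₂ := biprod.snd
  τ₃ := l₁₃ hc₃
  comm₁₂ := by
    change (-𝟙 _) ≫ D.f.τ₁ = biprod.lift D.X₁.f (-D.f.τ₁) ≫ biprod.snd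
    rw [biprod.lift_snd, Preadditive.neg_comp, id_comp]
  comm₂₃ := by
    change biprod.snd ≫ D.g.τ₁ = biprod.desc (a D) (b D) ≫ l₁₃ hc₃
    refine biprod.hom_ext' _ _ ?_ ?_
    · rw [biprod.inl_snd_assoc, biprod.inl_desc_assoc, a_l₁₃, zero_comp]
    · rw [biprod.inr_snd_assoc, biprod.inr_desc_assoc, b_l₁₃]

end Abelian

/-! ### The anticommutation in the derived category -/

section Derived

variable {C : Type u} [Category.{v} C] [Abelian C] [HasDerivedCategory.{w} C]
  {D : ShortComplex (ShortComplex (CochainComplex C ℤ))}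
  (hr₁ : (row₁ D).ShortExact) (hr₃ : (row₃ D).ShortExact)
  (hc₁ : D.X₁.ShortExact) (hc₂ : D.X₂.ShortExact) (hc₃ : D.X₃.ShortExact)

open DerivedCategory

include hc₂ in
/-- `Q(l₃₁) ≫ δ(col₁) = δ_Θ`. [folklore] -/
theorem map_l₃₁_comp_triangleOfSESδ :
    (triangleOfSESδ (theta_shortExact D hc₁ hc₂ hr₃) : Q.obj (K D) ⟶ (Q.obj D.X₁.X₁)⟦(1 : ℤ)⟧) =
      Q.map (l₃₁ hr₃) ≫ triangleOfSESδ hc₁ := by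
  have h := triangleOfSESδ_naturality (theta_shortExact D hc₁ hc₂ hr₃) hc₁ (thetaToCol₁ hr₃)
  dsimp only [thetaToCol₁] at h
  rw [CategoryTheory.Functor.map_id, CategoryTheory.Functor.map_id, comp_id] at h
  exact h

include hc₁ hc₂ hr₃ in
/-- `Q(l₁₃) ≫ δ(row₁) = -δ_Θ`. [folklore] -/
theorem map_l₁₃_comp_triangleOfSESδ :
    -(triangleOfSESδ (theta_shortExact D hc₁ hc₂ hr₃) : Q.obj (K D) ⟶ (Q.obj D.X₁.X₁)⟦(1 : ℤ)⟧) =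
      Q.map (l₁₃ hc₃) ≫ triangleOfSESδ hr₁ := by
  have h := triangleOfSESδ_naturality (theta_shortExact D hc₁ hc₂ hr₃) hr₁ (thetaToRow₁ hc₃)
  dsimp only [thetaToRow₁] at h
  rw [Functor.map_neg, Functor.map_neg, CategoryTheory.Functor.map_id, CategoryTheory.Functor.map_id,
    Preadditive.comp_neg, comp_id] at h
  exact h

include hc₂ in
/-- `δ(row₃) = δ_Σ ≫ Q(l₃₁)⟦1⟧'`. [folklore] -/
theorem triangleOfSESδ_row₃_eq :
    triangleOfSESδ hr₃ =
      triangleOfSESδ (haveI := hc₂.epi_g; haveI := hr₃.epi_g; sigma_shortExact D) ≫ (Q.map (l₃₁ hr₃))⟦(1 : ℤ)⟧' := by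
  haveI := hc₂.epi_g; haveI := hr₃.epi_g
  have h := triangleOfSESδ_naturality (sigma_shortExact D) hr₃ (sigmaToRow₃ hr₃)
  dsimp only [sigmaToRow₃] at h
  rw [CategoryTheory.Functor.map_id, id_comp] at h
  exact h.symm

include hc₂ hr₃ in
/-- `δ(col₃) = δ_Σ ≫ Q(l₁₃)⟦1⟧'`. [folklore] -/
theorem triangleOfSESδ_col₃_eq :
    triangleOfSESδ hc₃ =
      triangleOfSESδ (haveI := hc₂.epi_g; haveI := hr₃.epi_g; sigma_shortExact D) ≫ (Q.map (l₁₃ hc₃))⟦(1 : ℤ)⟧' := by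
  haveI := hc₂.epi_g; haveI := hr₃.epi_g
  have h := triangleOfSESδ_naturality (sigma_shortExact D) hc₃ (sigmaToCol₃ hc₃)
  dsimp only [sigmaToCol₃] at h
  rw [CategoryTheory.Functor.map_id, id_comp] at h
  exact h.symm

include hc₂ hc₃ hr₁ in
/-- **The two composite connecting morphisms of a `3 × 3` diagram anticommute**:
`δ(row₃) ≫ δ(col₁)⟦1⟧' = -(δ(col₃) ≫ δ(row₁)⟦1⟧') : Q A₃₃ ⟶ (Q A₁₁)⟦1⟧⟦1⟧`.
[folklore] -/
theorem triangleOfSESδ_row₃_col₁_eq_neg :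
    triangleOfSESδ hr₃ ≫ (triangleOfSESδ hc₁)⟦(1 : ℤ)⟧' = -(triangleOfSESδ hc₃ ≫ (triangleOfSESδ hr₁)⟦(1 : ℤ)⟧') := by
  rw [triangleOfSESδ_row₃_eq hr₃ hc₂, triangleOfSESδ_col₃_eq hr₃ hc₂ hc₃, assoc, assoc, ← Functor.map_comp,
    ← Functor.map_comp, ← map_l₃₁_comp_triangleOfSESδ hr₃ hc₁ hc₂, ← map_l₁₃_comp_triangleOfSESδ hr₁ hr₃ hc₁ hc₂ hc₃,
    Functor.map_neg, Preadditive.comp_neg, neg_neg]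

include hc₂ hc₃ hr₁ in
/-- **The same in `ShiftedHom.comp` form** (degrees `1 + 1 = 2`): `δ(row₃) · δ(col₁) = -(δ(col₃) · δ(row₁))` in
`ShiftedHom (Q A₃₃) (Q A₁₁) 2`. [folklore] -/
theorem comp_triangleOfSESδ_anticomm :
    ShiftedHom.comp (M := ℤ) (a := 1) (b := 1) (c := 2) (triangleOfSESδ hr₃) (triangleOfSESδ hc₁) rfl =
      -ShiftedHom.comp (M := ℤ) (a := 1) (b := 1) (c := 2) (triangleOfSESδ hc₃) (triangleOfSESδ hr₁) rfl := by
  simp only [ShiftedHom.comp]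
  rw [← assoc, triangleOfSESδ_row₃_col₁_eq_neg hr₁ hr₃ hc₁ hc₂ hc₃, Preadditive.neg_comp, assoc]

end Derived

end NineDiagram

end Summit.Ventures.HSemireg

end
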